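import Mathlib.Algebra.Polynomial.Div
import Literature.Computability.AlgebraicComplexity.SchoenhageTauBini
import Literature.Computability.AlgebraicComplexity.AsymptoticSpectrum
import Literature.Computability.AlgebraicComplexity.TensorMultiples
import HarnessLib

/-!
# Border rank over `K[ε]`: restriction monotonicity, relabelling, Kronecker products and powers

Topic: `Literature/Computability/AlgebraicComplexity`. Elementary structural facts about the
algebraic border rank `algBorderRank` (`SchoenhageTau.lean`, Bläser 2013, Def. 6.1) that the
border-rank literature uses without comment (Conner–Gesmundo–Landsberg–Ventura 2022, §1.1:
"`R(T ⊠ T') ≤ R(T) R(T')`, and similarly for border rank"; "if `T'` is a degeneration of `T` then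
`bR(T') ≤ bR(T)`", here for restrictions), all PROVED, on top of `SchoenhageTauBini.lean`
(Bläser 2013, Thm. 6.3: `approxRank_precomp_le`, `approxRank_kroneckerTensor_le`; cf. also
`BorderRankKronecker.approxRank_kroneckerPow_le`):

* `isApproxDecomposition_iff` — an order-`h` approximate decomposition of `t` is a triad
  decomposition over `K[ε]` whose `(a,b,c)` entry is `ε^h · (t_{abc} + O(ε))`.
* `algBorderRank_precomp_le`, `algBorderRank_reindex` — relabelling coordinates along maps does
  not increase `bR`; along bijections it preserves it.
* `sum_restrict_triads`, `IsApproxDecomposition.restrict`, `TensorRestrictsTo.approxRank_le`,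
  `TensorRestrictsTo.algBorderRank_le`, `algBorderRank_restrict₁_le` — a restriction `t ≥ s`
  (`AsymptoticSpectrum.TensorRestrictsTo`: `s = (A ⊗ B ⊗ C) t`) satisfies `R_h(s) ≤ R_h(t)` and
  `bR(s) ≤ bR(t)`.
* `algBorderRank_kroneckerTensor_le` (`bR(s ⊠ t) ≤ bR(s) bR(t)`), `algBorderRank_kroneckerTensor_comm`,
  `algBorderRank_kroneckerPow_succ` (`bR(t^{⊠(N+1)}) = bR(t ⊠ t^{⊠N})`),
  `algBorderRank_kroneckerPow_le` (`bR(t^{⊠N}) ≤ bR(t)^N`).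

All index types of tensors whose `R_h` is used as an upper bound are finite (the infima defining
`approxRank`/`algBorderRank` are attained: `exists_isApproxDecomposition_approxRank`,
`exists_algBorderRank_eq_approxRank`).

## References

* M. Bläser, *Fast Matrix Multiplication*, Theory of Computing Graduate Surveys 5 (2013), Def. 6.1,
  Thm. 6.3.
* A. Conner, F. Gesmundo, J. M. Landsberg, E. Ventura, *Rank and border rank of Kronecker powers of
  tensors and Strassen's laser method*, comput. complexity 31 (2022), arXiv:1909.04785v2, §1.1.
-/

noncomputable section

open scoped BigOperators Polynomial

namespace Literature.Computability.AlgebraicComplexity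

universe u v₁ v₂ v₃ v₄ v₅ v₆

variable {K : Type u} [CommSemiring K]
variable {ι : Type v₁} {κ : Type v₂} {μ : Type v₃} {ι' : Type v₄} {κ' : Type v₅} {μ' : Type v₆}

/-! ## Approximate decompositions as `K[ε]`-decompositions of `ε^h (t + O(ε))` -/

/-- An order-`h` approximate decomposition of `t` (Bläser 2013, Def. 6.1) is exactly a triad
decomposition over `K[ε]` each of whose entries is `ε^h · Q_{abc}` with `Q_{abc}(0) = t_{abc}`.
[cite: Blaser2013, Def. 6.1] -/
theorem isApproxDecomposition_iff {h : ℕ} {t : ι → κ → μ → K} {r : ℕ} {u : Fin r → ι → K[X]}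
    {v : Fin r → κ → K[X]} {w : Fin r → μ → K[X]} :
    IsApproxDecomposition h t u v w ↔
      ∀ a b c, ∃ Q : K[X], (∑ ρ, u ρ a * v ρ b * w ρ c) = Polynomial.X ^ h * Q ∧ Q.coeff 0 = t a b c := by
  constructor
  · intro H a b c
    have hdvd : Polynomial.X ^ h ∣ ∑ ρ, u ρ a * v ρ b * w ρ c :=
      Polynomial.X_pow_dvd_iff.2 fun d hd => by rw [H a b c d hd.le, if_neg hd.ne]
    obtain ⟨Q, hQ⟩ := hdvd
    refine ⟨Q, hQ, ?_⟩
    have hh := H a b c h le_rfl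
    rw [if_pos rfl, hQ, Polynomial.coeff_X_pow_mul'] at hh
    simpa using hh
  · intro H a b c j hj
    obtain ⟨Q, hQ, hQ0⟩ := H a b c
    rw [hQ, Polynomial.coeff_X_pow_mul']
    by_cases hjh : j = h
    · subst hjh
      simp [hQ0]
    · rw [if_neg (fun hle => hjh (le_antisymm hj hle)), if_neg hjh]

/-! ## Relabelling coordinates -/

/-- `bR` does not increase under relabelling of coordinates along maps (finite source format); in
particular zero-padding / identifying coordinates (`SchoenhageTauBini.approxRank_precomp_le` for
`R_h`). [cite: ConnerGesmundoLandsbergVentura2022, §1.1] -/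
theorem algBorderRank_precomp_le [Fintype ι] [Fintype κ] [Fintype μ] [DecidableEq ι] [DecidableEq κ]
    [DecidableEq μ] (t : ι → κ → μ → K) (f : ι' → ι) (g : κ' → κ) (k : μ' → μ) :
    algBorderRank (fun a b c => t (f a) (g b) (k c)) ≤ algBorderRank t := by
  obtain ⟨h₀, hh₀⟩ := exists_algBorderRank_eq_approxRank t
  calc algBorderRank (fun a b c => t (f a) (g b) (k c))
        ≤ approxRank h₀ (fun a b c => t (f a) (g b) (k c)) := algBorderRank_le_approxRank h₀ _
    _ ≤ approxRank h₀ t := approxRank_precomp_le h₀ t f g k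
    _ = algBorderRank t := hh₀.symm

/-- **Border rank is invariant under relabelling the coordinates by bijections** (isomorphic
tensors have the same border rank). [cite: ConnerGesmundoLandsbergVentura2022, §1.1] -/
theorem algBorderRank_reindex [Fintype ι] [Fintype κ] [Fintype μ] [DecidableEq ι] [DecidableEq κ]
    [DecidableEq μ] [Fintype ι'] [Fintype κ'] [Fintype μ'] [DecidableEq ι'] [DecidableEq κ']
    [DecidableEq μ'] (eι : ι' ≃ ι) (eκ : κ' ≃ κ) (eμ : μ' ≃ μ) (t : ι → κ → μ → K) :
    algBorderRank (fun a b c => t (eι a) (eκ b) (eμ c)) = algBorderRank t := by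
  refine le_antisymm (algBorderRank_precomp_le t eι eκ eμ) ?_
  have key := algBorderRank_precomp_le (fun a' b' c' => t (eι a') (eκ b') (eμ c')) eι.symm eκ.symm
    eμ.symm
  simp only [Equiv.apply_symm_apply] at key
  exact key

/-! ## Restriction monotonicity -/

section Restrict

variable [Fintype ι] [Fintype κ] [Fintype μ]

/-- Expanding a product of three matrix-times-vector sums and summing over the triads:
`∑_ρ (A u_ρ)(a') (B v_ρ)(b') (C w_ρ)(c') = ∑_{a,b,c} A_{a'a} B_{b'b} C_{c'c} ∑_ρ u_ρ(a) v_ρ(b) w_ρ(c)`.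
[folklore] -/
theorem sum_restrict_triads {R : Type*} [CommSemiring R] {r : ℕ} (u : Fin r → ι → R)
    (v : Fin r → κ → R) (w : Fin r → μ → R) (α : ι → R) (β : κ → R) (γ : μ → R) :
    ∑ ρ, (∑ a, α a * u ρ a) * (∑ b, β b * v ρ b) * (∑ c, γ c * w ρ c) =
      ∑ a, ∑ b, ∑ c, α a * β b * γ c * ∑ ρ, u ρ a * v ρ b * w ρ c := by
  calc ∑ ρ, (∑ a, α a * u ρ a) * (∑ b, β b * v ρ b) * (∑ c, γ c * w ρ c)
      = ∑ ρ, ∑ a, ∑ b, ∑ c, α a * β b * γ c * (u ρ a * v ρ b * w ρ c) := by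
        refine Finset.sum_congr rfl fun ρ _ => ?_
        rw [Finset.sum_mul_sum, Finset.sum_mul]
        refine Finset.sum_congr rfl fun a _ => ?_
        rw [Finset.sum_mul]
        refine Finset.sum_congr rfl fun b _ => ?_
        rw [Finset.mul_sum]
        exact Finset.sum_congr rfl fun c _ => by ring
    _ = ∑ a, ∑ b, ∑ c, α a * β b * γ c * ∑ ρ, u ρ a * v ρ b * w ρ c := by
        rw [Finset.sum_comm]
        refine Finset.sum_congr rfl fun a _ => ?_
        rw [Finset.sum_comm]
        refine Finset.sum_congr rfl fun b _ => ?_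
        rw [Finset.sum_comm]
        refine Finset.sum_congr rfl fun c _ => ?_
        rw [Finset.mul_sum]

/-- Applying linear maps (matrices `A, B, C`) in the three factors transports an approximate
decomposition: a restriction of `t` inherits `R_h(t)` triads of order `h`. [folklore] -/
theorem IsApproxDecomposition.restrict {h : ℕ} {t : ι → κ → μ → K} {r : ℕ} {u : Fin r → ι → K[X]}
    {v : Fin r → κ → K[X]} {w : Fin r → μ → K[X]} (H : IsApproxDecomposition h t u v w)
    (A : ι' → ι → K) (B : κ' → κ → K) (C : μ' → μ → K) :
    IsApproxDecomposition h (fun a' b' c' => ∑ a, ∑ b, ∑ c, A a' a * B b' b * C c' c * t a b c)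
      (fun ρ a' => ∑ a, Polynomial.C (A a' a) * u ρ a)
      (fun ρ b' => ∑ b, Polynomial.C (B b' b) * v ρ b)
      (fun ρ c' => ∑ c, Polynomial.C (C c' c) * w ρ c) := by
  rw [isApproxDecomposition_iff] at H ⊢
  intro a' b' c'
  choose Q hQ hQ0 using H
  refine ⟨∑ a, ∑ b, ∑ c, Polynomial.C (A a' a * B b' b * C c' c) * Q a b c, ?_, ?_⟩
  · rw [sum_restrict_triads, Finset.mul_sum]
    refine Finset.sum_congr rfl fun a _ => ?_
    rw [Finset.mul_sum]
    refine Finset.sum_congr rfl fun b _ => ?_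
    rw [Finset.mul_sum]
    refine Finset.sum_congr rfl fun c _ => ?_
    rw [hQ a b c, map_mul, map_mul]
    ring
  · simp only [Polynomial.finsetSum_coeff, Polynomial.coeff_C_mul, hQ0]

variable [DecidableEq ι] [DecidableEq κ] [DecidableEq μ]

/-- **`R_h` is monotone under restriction**: `t ≥ s ⇒ R_h(s) ≤ R_h(t)`. [folklore] -/
theorem TensorRestrictsTo.approxRank_le {t : ι → κ → μ → K} {s : ι' → κ' → μ' → K}
    (hts : TensorRestrictsTo t s) (h : ℕ) : approxRank h s ≤ approxRank h t := by
  obtain ⟨A, B, C, hs⟩ := hts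
  obtain ⟨u, v, w, huvw⟩ := exists_isApproxDecomposition_approxRank h t
  have hs' : s = fun a' b' c' => ∑ a, ∑ b, ∑ c, A a' a * B b' b * C c' c * t a b c :=
    funext fun a' => funext fun b' => funext fun c' => hs a' b' c'
  rw [hs']
  exact approxRank_le_of_isApproxDecomposition (huvw.restrict A B C)

/-- **Border rank is monotone under restriction**: `t ≥ s ⇒ bR(s) ≤ bR(t)` (the restriction case
of "border rank is upper semi-continuous under degeneration", CGLV §1.1).
[cite: ConnerGesmundoLandsbergVentura2022, §1.1] -/
theorem TensorRestrictsTo.algBorderRank_le {t : ι → κ → μ → K} {s : ι' → κ' → μ' → K}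
    (hts : TensorRestrictsTo t s) : algBorderRank s ≤ algBorderRank t := by
  obtain ⟨h₀, hh₀⟩ := exists_algBorderRank_eq_approxRank t
  calc algBorderRank s ≤ approxRank h₀ s := algBorderRank_le_approxRank h₀ s
    _ ≤ approxRank h₀ t := hts.approxRank_le h₀
    _ = algBorderRank t := hh₀.symm

/-- Applying a linear map in the first factor only (`B = C = 1`) does not increase `bR`
(the "by linearity" step for Koszul flattenings after a restriction `φ : A → A'`).
[cite: ConnerGesmundoLandsbergVentura2022, §3] -/
theorem algBorderRank_restrict₁_le (t : ι → κ → μ → K)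
    (A : ι' → ι → K) : algBorderRank (fun a' b c => ∑ a, A a' a * t a b c) ≤ algBorderRank t := by
  refine TensorRestrictsTo.algBorderRank_le ⟨A, fun b' b => if b = b' then 1 else 0,
    fun c' c => if c = c' then 1 else 0, fun a' b' c' => ?_⟩
  refine Finset.sum_congr rfl fun a _ => ?_
  rw [Finset.sum_eq_single b' (fun b _ hb => by simp [hb]) (by simp),
    Finset.sum_eq_single c' (fun c _ hc => by simp [hc]) (by simp)]
  simp

end Restrict

/-! ## Kronecker products and powers -/

section Kronecker

variable [Fintype ι] [Fintype κ] [Fintype μ] [DecidableEq ι] [DecidableEq κ] [DecidableEq μ]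
  [Fintype ι'] [Fintype κ'] [Fintype μ'] [DecidableEq ι'] [DecidableEq κ'] [DecidableEq μ']

/-- **Border rank is submultiplicative under the Kronecker product**: `bR(s ⊠ t) ≤ bR(s) bR(t)`
(CGLV §1.1: "`R(T ⊠ T') ≤ R(T) R(T')`, and similarly for border rank"; from Bläser 2013,
Thm. 6.3(3) `R_{h+h'}(s ⊠ t) ≤ R_h(s) R_{h'}(t)` at orders attaining the two border ranks).
[cite: ConnerGesmundoLandsbergVentura2022, §1.1] -/
theorem algBorderRank_kroneckerTensor_le (s : ι → κ → μ → K) (t : ι' → κ' → μ' → K) :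
    algBorderRank (kroneckerTensor s t) ≤ algBorderRank s * algBorderRank t := by
  obtain ⟨h₀, hh₀⟩ := exists_algBorderRank_eq_approxRank s
  obtain ⟨h₁, hh₁⟩ := exists_algBorderRank_eq_approxRank t
  calc algBorderRank (kroneckerTensor s t)
        ≤ approxRank (h₀ + h₁) (kroneckerTensor s t) := algBorderRank_le_approxRank _ _
    _ ≤ approxRank h₀ s * approxRank h₁ t := approxRank_kroneckerTensor_le h₀ h₁ s t
    _ = algBorderRank s * algBorderRank t := by rw [hh₀, hh₁]

/-- `bR(s ⊠ t) = bR(t ⊠ s)` (the two products differ by relabelling). [folklore] -/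
theorem algBorderRank_kroneckerTensor_comm (s : ι → κ → μ → K) (t : ι' → κ' → μ' → K) :
    algBorderRank (kroneckerTensor s t) = algBorderRank (kroneckerTensor t s) := by
  have hst : kroneckerTensor s t = fun a b c =>
      kroneckerTensor t s (Equiv.prodComm ι ι' a) (Equiv.prodComm κ κ' b) (Equiv.prodComm μ μ' c) := by
    funext a b c
    simp [mul_comm]
  rw [hst]
  exact algBorderRank_reindex (Equiv.prodComm ι ι') (Equiv.prodComm κ κ') (Equiv.prodComm μ μ')
    (kroneckerTensor t s)

omit [Fintype ι'] [Fintype κ'] [Fintype μ'] [DecidableEq ι'] [DecidableEq κ'] [DecidableEq μ'] in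
/-- `bR(t^{⊠(N+1)}) = bR(t ⊠ t^{⊠N})` (split off the first coordinate; the two tensors differ by the
relabelling `a ↦ (a 0, tail a)` / `(x, y) ↦ cons x y`). [folklore] -/
theorem algBorderRank_kroneckerPow_succ (t : ι → κ → μ → K) (N : ℕ) :
    algBorderRank (kroneckerPow t (N + 1)) = algBorderRank (kroneckerTensor t (kroneckerPow t N)) := by
  refine le_antisymm ?_ ?_
  · rw [kroneckerPow_succ_eq]
    exact algBorderRank_precomp_le _ _ _ _
  · have hcons : kroneckerTensor t (kroneckerPow t N) = fun a b c =>
        kroneckerPow t (N + 1) (Fin.cons a.1 a.2) (Fin.cons b.1 b.2) (Fin.cons c.1 c.2) := by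
      funext a b c
      simp [Fin.prod_univ_succ]
    rw [hcons]
    exact algBorderRank_precomp_le _ _ _ _

omit [Fintype ι'] [Fintype κ'] [Fintype μ'] [DecidableEq ι'] [DecidableEq κ'] [DecidableEq μ'] in
/-- **`bR(t^{⊠N}) ≤ bR(t)^N`** (iterate submultiplicativity; `t^{⊠0} ≅ ⟨1⟩` has border rank `≤ 1`).
[cite: ConnerGesmundoLandsbergVentura2022, §1.1] -/
theorem algBorderRank_kroneckerPow_le (t : ι → κ → μ → K) (N : ℕ) :
    algBorderRank (kroneckerPow t N) ≤ algBorderRank t ^ N := by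
  induction N with
  | zero =>
    have h0 : tensorRank (kroneckerPow t 0) ≤ 1 := by simpa using tensorRank_kroneckerPow_le t 0
    simpa using (algBorderRank_le_tensorRank _).trans h0
  | succ N ih =>
    rw [algBorderRank_kroneckerPow_succ, pow_succ, mul_comm]
    exact (algBorderRank_kroneckerTensor_le _ _).trans (Nat.mul_le_mul_left _ ih)

end Kronecker

end Literature.Computability.AlgebraicComplexity

end
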